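import Summits.ResolutionOfSingularities.ResolutionOfSingularities.Theorems.MarkedTransferCampaignW25FiniteRaySW
import Literature.AlgebraicGeometry.Hironaka2017.Proofs.S09LLUED.Lem95CoupledBox
import HarnessLib

/-!
# K2.5 record, carrier SB: NO finite IN-BOX ray modulo `M_<` (res-adj-2's (β) of the K25 VERDICT line, in the kernel)
# — slot W2.5 = L-47B-s3 «FINITE AB-RAY SUFFICES» (DEAD 06:16:15Z), MODEL of record B1–B4 of PREREG-K25 (k25, p502943)

[OURS · L W2.5 · K2.5 record] HIRONAKA CAMPAIGN D-0089, rescue ladder L, group G2 (§9 `H♭`), GAP row R47 (B) (Lemma 9.5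
p.50 l.11–14, COUPLED depth choice). res-adj-2's K25 VERDICT = DEAD (HOME/STATUS.md 2026-08-27T06:16:15Z) adds, under the
K24 «Frobenius box» reading of «derivative orders `< p^ℓ`» (each COORDINATE of `qγ` `< p^ℓ`, the condition the
`H♭`-calculus consumes: `∂(uX) = u∂X`, p.49 l.25–28), a hand derivation (β): on the carrier SB = `Σ_{k≥1} ω₁^{2k}ω₂³`
(res-type-055, `Lem95CoupledBox`, p491132) there is NO `ε′ ≡ E_SB (mod M_<)` with a depth-`ℓ` standard expression whose
top block lies in the box, `ℓ ≥ 2`, and asks for the kernel certificate `SB.not_existsAdmissibleFiniteRay_box`. THIS FILE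
is that certificate, for the MODEL OF RECORD of the kill test (res-L1-k25 = res-D-pv-021, PREREG sha16 014aa455e686b865,
defs `CampaignW25.SW.IsBelowRay` / `MemBelow` of p502943: `M_<` = series all of whose monomials have digit pair
`<lex (α, β) = (e₂, 0)`, i.e. on these carriers ALL EXPONENTS EVEN, `SW.isBelowRay_SW_iff`). It words no verdict and
asserts nothing of H. Hironaka's manuscript [Hironaka2017] (lit key `paper:url-3343fd9e678b`), which stays «under review»
(D-0012/D-0089). Typed by res-type-054 (W2.5 statement typer) on res-adj-2's ASK; AI-written, weaker than expert review.

## RESULT (every `ℓ ≥ 2`; `E_SB = toFin 𝔽 2 εB ∈ 𝔽₂⟦x₀, x₁, x₂⟧`, `x₀ = y`, `p = 2`, `e = 1`)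
For EVERY `ε′` with `E_SB − ε′ ∈ M_<` and EVERY standard expression `X′` of `ε′` of depth `ℓ`: `alpha X′ = e₂`,
`beta X′ = 0` (`topPair_eq`), and the top block of `X′` contains a term `(e₂, 0, c)` with `(2c)_{ω₁} ≥ 2^ℓ = p^ℓ`
(`exists_topBlock_coord_ge`) — OUTSIDE the box, a fortiori of total degree `≥ 2^ℓ`. Route (res-adj-2's, with the last
step by residue-class visibility instead of a cancellation argument): the monomial `ω₁^{2^ℓ} ω₂³` of `E_SB` has odd
`ω₂`-exponent, so `M_<` cannot touch it and some effective term `t = (a, 0, c_t)` of `X′` carries it; parity of the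
`ω₂`-coordinate forces `a = e₂`, and the `ω₁`-coordinate gives `2c_{t,1} + 2^ℓ κ₁ = 2^ℓ`, so `c_{t,1} ≡ 0 (mod 2^{ℓ−1})`;
the visible member `s` of `t`'s residue class (`Lem95Coupled.exists_coeff_ne_zero_modEq_of_mem_effSupport`: an effective
term with the same digits, `c_s ≡ c_t (mod 2^{ℓ−1})`, `coeff_{θ_s} ε′ ≠ 0`) then has `θ_s = (0, 2c_{s,1}, 3)` a monomial of
`E_SB`, so `c_{s,1} ≥ 1` and `c_{s,1} ≡ 0 (mod 2^{ℓ−1})`, whence `2c_{s,1} ≥ 2^ℓ`. Corollaries: `not_existsAdmissibleFiniteRay_box`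
(box form, every `ℓ ≥ 2`), `not_existsAdmissibleFiniteRay` (k25's total-degree form `SW.AdmissibleTop` on SB),
instances `ℓ = 3, 4`.

## SCOPE NOTE (recorded on STATUS 2026-08-27T06:20:48Z; not certified here)
Under the SECOND reading of «below the AB-ray» (p502315 `CampaignW25.IsBelowRay`: a same-pair monomial lexicographically
below EVERY ray member also counts) the class `M_<` of SB is LARGER (it contains `ω₂³ · ρ^ℓ(O)`, hence the ray members
`ω₁^{2^ℓ κ} ω₂³`), and the box form of the question has a POSITIVE answer on SB (`ε′ = Σ_{2^{ℓ−1} ∤ k} ω₁^{2k} ω₂³`, top block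
`{(e₂,0,(0,r,1)) : 1 ≤ r < 2^{ℓ−1}}`, max coordinate `2^ℓ − 2`). The present file is about the model of record only.

References: H. Hironaka, ms. 2017-03-23, Eq. (76)/(77) p.49, Lem. 9.5 p.50 l.11–15, p.49 l.25–28 (UNDER ADJUDICATION,
not cited as fact). [Hironaka2017] -/

-- `Summit.<Summit>.<Sub>.Theorems` with `Sub = Summit` (single-conjunct summit, D-0017)
set_option linter.dupNamespace false

noncomputable section

namespace Summit.ResolutionOfSingularities.ResolutionOfSingularities.Theorems.CampaignW25.SB

open MvPowerSeries
open Literature.AlgebraicGeometry.Hironaka2017.S09LLUED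
open Literature.AlgebraicGeometry.Hironaka2017.S09LLUED.TopFrontier
open Literature.AlgebraicGeometry.Hironaka2017.S09LLUED.Lem95Coupled
open Literature.AlgebraicGeometry.Hironaka2017.S09LLUED.Lem95CoupledBox
open Literature.AlgebraicGeometry.Hironaka2017.S08UnitMonomial (StandardExpression)
open Literature.AlgebraicGeometry.Hironaka2017.S07Permissible.Cor720Countermodel (𝔽)
open Summit.ResolutionOfSingularities.ResolutionOfSingularities.Theorems.CampaignW25.SW
  (IsBelowRay MemBelow isBelowRay_SW_iff snd_fst_eq_zero AdmissibleTop)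

/-! ## §1 Every standard expression of every `ε′ ≡ E_SB (mod M_<)` -/

section StdExpr

variable {ℓ : ℕ} {ε' : MvPowerSeries (Fin 3) 𝔽}
  (hB : MemBelow 2 1 (Finsupp.single 2 1) 0 (toFin 𝔽 2 εB - ε'))
  (X : StandardExpression 2 MvPowerSeries.X 1 ℓ ε')

include hB in
/-- A monomial NOT below the AB-ray has the same coefficient in `ε′` as in `E_SB` (`M_<` cannot touch it).
[cite: Hironaka2017, Eq. (76) p.49 l.5–20 (kernel certificate about OUR typed kill-test model; nothing of the manuscript asserted)] -/
theorem coeff_eq_of_not_isBelowRay {m : Fin 3 →₀ ℕ} (hm : ¬ IsBelowRay 2 1 (Finsupp.single 2 1) 0 m) :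
    coeff m ε' = coeff m (toFin 𝔽 2 εB) := by
  by_contra hne
  apply hm
  apply hB m
  rw [map_sub, sub_ne_zero]
  exact Ne.symm hne

include hB in
/-- The monomials of `ε′`: either a ray monomial of `E_SB` (`(0, 2k, 3)`, `k ≥ 1`, coefficient `1`) or all exponents
even. [cite: Hironaka2017, Eq. (76) p.49 l.5–20 (kernel certificate about OUR model)] -/
theorem coeff_ne_zero_cases {m : Fin 3 →₀ ℕ} (hm : coeff m ε' ≠ 0) :
    (m 0 = 0 ∧ 2 ∣ m 1 ∧ m 1 ≠ 0 ∧ m 2 = 3) ∨ ∀ i, 2 ∣ m i := by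
  by_cases hb : IsBelowRay 2 1 (Finsupp.single 2 1) 0 m
  · exact Or.inr ((isBelowRay_SW_iff m).1 hb)
  · left
    rw [coeff_eq_of_not_isBelowRay hB hb, coeff_E] at hm
    by_contra h
    exact hm (if_neg h)

include hB in
/-- **Shape of the effective terms.** Every effective term `t = (a, b, c)` of a standard expression of `ε′` of depth
`ℓ ≥ 1` has `b = 0` and `a ∈ {e₂, 0}` (same shape as on SW, `SW.shape_of_mem_effSupport`; private here — the gate's
dedup treats the two carriers' statements as one shape). [cite: Hironaka2017, Eq. (76) p.49 l.5–22 (kernel certificate about OUR model)] -/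
private theorem shape_of_mem_effSupport (hℓ : 1 ≤ ℓ) {t : ExpTriple 3} (ht : t ∈ effSupport X.support X.u) :
    t.2.1 = 0 ∧ (t.1 = Finsupp.single 2 1 ∨ t.1 = 0) := by
  have htT : t ∈ X.support := effSupport_subset _ _ ht
  have hb : t.2.1 = 0 := snd_fst_eq_zero X htT
  obtain ⟨s, hs, hs1, hs2, -, hcoeff⟩ := exists_coeff_ne_zero_modEq_of_mem_effSupport le_rfl hℓ X ht
  have hsT : s ∈ X.support := effSupport_subset _ _ hs
  have hsb : s.2.1 = 0 := snd_fst_eq_zero X hsT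
  have ha : ∀ i, s.1 i < 2 := fun i => X.a_lt s hsT i
  refine ⟨hb, ?_⟩
  rw [← hs1]
  rcases coeff_ne_zero_cases hB hcoeff with ⟨h0, h1, -, h2⟩ | hev
  · left
    simp only [hsb, smul_zero, add_zero, Finsupp.add_apply, Finsupp.smul_apply, smul_eq_mul, pow_one] at h0 h1 h2
    have ha0 : s.1 0 = 0 := by omega
    have ha1 : s.1 1 = 0 := by have := ha 1; omega
    have ha2 : s.1 2 = 1 := by have := ha 2; omega
    ext i
    fin_cases i
    · simpa using ha0
    · simpa using ha1
    · simpa using ha2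
  · right
    ext i
    have h := hev i
    simp only [hsb, smul_zero, add_zero, Finsupp.add_apply, Finsupp.smul_apply, smul_eq_mul, pow_one] at h
    have := ha i
    simp only [Finsupp.coe_zero, Pi.zero_apply]
    omega

include hB in
/-- **The large effective term.** For `ℓ ≥ 2`: some effective term `s = (e₂, 0, c)` of `X′` has `2c_{ω₁} ≥ 2^ℓ`
(the visible member of the residue class of the carrier of `ω₁^{2^ℓ} ω₂³`).
[cite: Hironaka2017, Eq. (76)/(77) p.49 (kernel certificate about OUR model)] -/
theorem exists_large_term (hℓ : 2 ≤ ℓ) :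
    ∃ s ∈ effSupport X.support X.u, s.1 = Finsupp.single 2 1 ∧ s.2.1 = 0 ∧ 2 ^ ℓ ≤ 2 * s.2.2 1 := by
  have hpow : 2 ^ ℓ = 2 * 2 ^ (ℓ - 1) := by
    rw [← pow_succ', Nat.sub_add_cancel (by omega : 1 ≤ ℓ)]
  have hP : 2 ≤ 2 ^ (ℓ - 1) := by
    calc 2 = 2 ^ 1 := by norm_num
      _ ≤ 2 ^ (ℓ - 1) := Nat.pow_le_pow_right (by norm_num) (by omega)
  have n12 : (1 : Fin 3) ≠ 2 := by decide
  have n21 : (2 : Fin 3) ≠ 1 := by decide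
  have n01 : (0 : Fin 3) ≠ 1 := by decide
  have n02 : (0 : Fin 3) ≠ 2 := by decide
  set m : Fin 3 →₀ ℕ := Finsupp.single 1 (2 ^ ℓ) + Finsupp.single 2 3 with hm
  have hm0 : m 0 = 0 := by
    simp only [m, Finsupp.add_apply, Finsupp.single_eq_of_ne n01, Finsupp.single_eq_of_ne n02, add_zero]
  have hm1 : m 1 = 2 ^ ℓ := by
    simp only [m, Finsupp.add_apply, Finsupp.single_eq_same, Finsupp.single_eq_of_ne n12, add_zero]
  have hm2 : m 2 = 3 := by
    simp only [m, Finsupp.add_apply, Finsupp.single_eq_same, Finsupp.single_eq_of_ne n21, zero_add]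
  -- `ω₁^{2^ℓ} ω₂³` is on the ray of `E_SB` (odd `ω₂`-exponent): coefficient `1` in `ε′`
  have hnot : ¬ IsBelowRay 2 1 (Finsupp.single 2 1) 0 m := by
    rw [isBelowRay_SW_iff]
    intro h
    have := h 2
    rw [hm2] at this
    omega
  have hcoeff : coeff m ε' ≠ 0 := by
    rw [coeff_eq_of_not_isBelowRay hB hnot, coeff_E, hm0, hm1, hm2,
      if_pos ⟨rfl, ⟨2 ^ (ℓ - 1), by omega⟩, by positivity, rfl⟩]
    exact one_ne_zero
  obtain ⟨t, ht, k, hk⟩ := exists_mem_effSupport_of_coeff_ne_zero' X hcoeff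
  obtain ⟨hb, ha⟩ := shape_of_mem_effSupport hB X (by omega) ht
  rw [hb] at hk
  -- coordinate 2 forces `a = e₂`
  have hk2 := DFunLike.congr_fun hk 2
  rw [hm2] at hk2
  simp only [Finsupp.add_apply, Finsupp.smul_apply, smul_eq_mul, Finsupp.coe_zero, Pi.zero_apply, mul_zero,
    add_zero, pow_one] at hk2
  have ha2 : t.1 = Finsupp.single 2 1 := by
    rcases ha with h | h
    · exact h
    · exfalso
      rw [h, Finsupp.coe_zero, Pi.zero_apply, zero_add] at hk2
      obtain ⟨z, hz⟩ : 2 ∣ 2 ^ ℓ * k 2 := Dvd.dvd.mul_right (dvd_pow_self 2 (by omega)) _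
      rw [hz] at hk2
      omega
  rw [ha2] at hk
  -- coordinate 1: `2 c_{t,1} + 2^ℓ κ₁ = 2^ℓ`, hence `c_{t,1} ≡ 0 (mod 2^{ℓ−1})`
  have hk1 : 2 ^ ℓ = 2 * t.2.2 1 + 2 ^ ℓ * k 1 := by
    have h := DFunLike.congr_fun hk 1
    rw [hm1] at h
    simpa only [Finsupp.add_apply, Finsupp.smul_apply, smul_eq_mul, Finsupp.coe_zero, Pi.zero_apply,
      mul_zero, add_zero, Finsupp.single_eq_of_ne n12, zero_add, pow_one] using h
  have ht1 : t.2.2 1 % 2 ^ (ℓ - 1) = 0 := by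
    rcases Nat.eq_zero_or_pos (k 1) with h0 | hpos
    · rw [h0, mul_zero, add_zero, hpow] at hk1
      have : t.2.2 1 = 2 ^ (ℓ - 1) := by omega
      rw [this, Nat.mod_self]
    · have : 2 ^ ℓ ≤ 2 ^ ℓ * k 1 := Nat.le_mul_of_pos_right _ hpos
      have : t.2.2 1 = 0 := by omega
      rw [this, Nat.zero_mod]
  -- the visible member of `t`'s residue class
  obtain ⟨s, hs, hs1, hs2, hmod, hcoeff_s⟩ := exists_coeff_ne_zero_modEq_of_mem_effSupport le_rfl (by omega) X ht
  rw [ha2] at hs1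
  rw [hb] at hs2
  refine ⟨s, hs, hs1, hs2, ?_⟩
  have hmod1 : s.2.2 1 % 2 ^ (ℓ - 1) = 0 := by
    have := hmod 1
    unfold Nat.ModEq at this
    rw [this, ht1]
  rcases coeff_ne_zero_cases hB hcoeff_s with ⟨-, -, h1, -⟩ | hev
  · -- ray monomial `(0, 2 c_{s,1}, 3)` of `E_SB`: `c_{s,1} ≥ 1` and `≡ 0 (mod 2^{ℓ−1})`
    rw [hs1, hs2] at h1
    simp only [smul_zero, add_zero, Finsupp.add_apply, Finsupp.smul_apply, smul_eq_mul, pow_one,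
      Finsupp.single_eq_of_ne n12] at h1
    have hs1pos : 0 < s.2.2 1 := by omega
    obtain ⟨w, hw⟩ := Nat.dvd_of_mod_eq_zero hmod1
    have hwpos : 0 < w := by
      rcases Nat.eq_zero_or_pos w with h0 | h0
      · rw [h0, mul_zero] at hw; omega
      · exact h0
    calc 2 ^ ℓ = 2 * 2 ^ (ℓ - 1) := hpow
      _ ≤ 2 * (2 ^ (ℓ - 1) * w) := Nat.mul_le_mul_left 2 (Nat.le_mul_of_pos_right _ hwpos)
      _ = 2 * s.2.2 1 := by rw [hw]
  · -- an even monomial would have even `ω₂`-exponent `1 + 2 c_{s,2}`: impossible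
    exfalso
    have h := hev 2
    rw [hs1, hs2] at h
    simp only [smul_zero, add_zero, Finsupp.add_apply, Finsupp.smul_apply, smul_eq_mul, pow_one,
      Finsupp.single_eq_same] at h
    omega

/-- `toLex 0 ≤ toLex f` on `ℕ³`. [folklore] -/
private theorem toLex_zero_le (f : Fin 3 →₀ ℕ) : toLex (0 : Fin 3 →₀ ℕ) ≤ toLex f :=
  Finsupp.toLex_monotone (by intro i; simp)

include hB in
/-- Every effective term has pair key `≤` that of a term of pair `(e₂, 0)`. [folklore] -/
private theorem pairKey_le_of_large (hℓ : 2 ≤ ℓ) {t : ExpTriple 3}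
    (ht1 : t.1 = Finsupp.single 2 1) (ht2 : t.2.1 = 0) :
    ∀ s ∈ effSupport X.support X.u, pairKey s ≤ pairKey t := by
  intro s hs
  obtain ⟨hsb, hsa⟩ := shape_of_mem_effSupport hB X (by omega) hs
  rcases hsa with h | h
  · rw [pairKey_eq_of_eq (h.trans ht1.symm) (hsb.trans ht2.symm)]
  · unfold pairKey
    rw [h, hsb, ht1, ht2, Prod.Lex.toLex_le_toLex]
    left
    show toLex (0 : Fin 3 →₀ ℕ) < toLex (Finsupp.single (2 : Fin 3) 1)
    exact lt_of_le_of_ne (toLex_zero_le _) (by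
      intro heq
      have := DFunLike.congr_fun (toLex_inj.1 heq) 2
      simp at this)

include hB in
/-- **(i) is automatic on SB: `(α, β) = (e₂, 0)`** for every standard expression of `ε′` (depth `ℓ ≥ 2`) — both
components in one statement (the SW analogues are `SW.alpha_eq` / `SW.beta_eq`, p502943).
[cite: Hironaka2017, Eq. (76) p.49 l.5 (kernel certificate about OUR model)] -/
theorem topPair_eq (hℓ : 2 ≤ ℓ) : alpha X.support X.u = Finsupp.single 2 1 ∧ beta X.support X.u = 0 := by
  obtain ⟨t, ht, ht1, ht2, -⟩ := exists_large_term hB X hℓ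
  rw [alpha_eq_of_isGreatest _ _ ht (pairKey_le_of_large hB X hℓ ht1 ht2),
    beta_eq_of_isGreatest _ _ ht (pairKey_le_of_large hB X hℓ ht1 ht2)]
  exact ⟨ht1, ht2⟩

include hB in
/-- **THE OBSTRUCTION ON SB (numbers for res-adj-2's (β)).** For `ℓ ≥ 2`, every standard expression of every
`ε′ ≡ E_SB (mod M_<)` has a TOP-BLOCK term `(e₂, 0, c)` with `(2c)_{ω₁} ≥ 2^ℓ = p^ℓ`: OUTSIDE the Frobenius box of
depth `ℓ` (and of total degree `|2c| ≥ 2^ℓ`). [cite: Hironaka2017, Lem. 9.5 p.50 l.11–14; p.49 l.25–28 (kernel certificate about OUR model; not a verdict)] -/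
theorem exists_topBlock_coord_ge (hℓ : 2 ≤ ℓ) :
    ∃ t ∈ topBlock X.support X.u, 2 ^ ℓ ≤ (2 • t.2.2) 1 := by
  obtain ⟨t, ht, ht1, ht2, hc1⟩ := exists_large_term hB X hℓ
  refine ⟨t, (mem_topBlock _ _).2 ⟨ht, ?_, ?_⟩, ?_⟩
  · rw [(topPair_eq hB X hℓ).1, ht1]
  · rw [(topPair_eq hB X hℓ).2, ht2]
  · simpa only [Finsupp.smul_apply, smul_eq_mul] using hc1

include hB in
/-- The same term has total degree `|2c| ≥ 2^ℓ`. [cite: Hironaka2017, Lem. 9.5 p.50 l.11–14 (kernel certificate about OUR model)] -/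
theorem exists_topBlock_degree_ge (hℓ : 2 ≤ ℓ) :
    ∃ t ∈ topBlock X.support X.u, 2 ^ ℓ ≤ (2 • t.2.2).degree := by
  obtain ⟨t, ht, hc⟩ := exists_topBlock_coord_ge hB X hℓ
  exact ⟨t, ht, le_trans hc (Finsupp.le_degree 1 _)⟩

end StdExpr

/-! ## §2 The box form and the total-degree form of the question on SB, every depth `ℓ ≥ 2` -/

/-- **K2.5 on SB, BOX reading, every depth `ℓ ≥ 2`: NO finite IN-BOX ray modulo `M_<`** (res-adj-2's (β),
`SB.not_existsAdmissibleFiniteRay_box`). There is no `ε′` with `E_SB − ε′ ∈ M_<` admitting a standard expression of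
depth `ℓ` with top pair `(e₂, 0)` all of whose top-block exponents `qγ = 2c` have EVERY COORDINATE `< 2^ℓ` (the box
condition is stated alone; the pair and `|α + pβ|` clauses of the PREREG are automatic here and omitted).
[cite: Hironaka2017, Lem. 9.5 p.50 l.11–14; p.49 l.25–28 (kernel certificate about OUR model; not a verdict)] -/
theorem not_existsAdmissibleFiniteRay_box {ℓ : ℕ} (hℓ : 2 ≤ ℓ) :
    ¬ ∃ ε' : MvPowerSeries (Fin 3) 𝔽, MemBelow 2 1 (Finsupp.single 2 1) 0 (toFin 𝔽 2 εB - ε') ∧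
      ∃ X : StandardExpression 2 MvPowerSeries.X 1 ℓ ε',
        ∀ t ∈ topBlock X.support X.u, ∀ i : Fin 3, (2 • t.2.2) i < 2 ^ ℓ := by
  rintro ⟨ε', hB, X, hbox⟩
  obtain ⟨t, ht, hc⟩ := exists_topBlock_coord_ge hB X hℓ
  exact absurd (hbox t ht 1) (not_lt.2 hc)

/-- **K2.5 on SB, TOTAL-DEGREE reading (k25's `SW.AdmissibleTop`), every depth `ℓ ≥ 2`: NO.**
[cite: Hironaka2017, Lem. 9.5 p.50 l.11–14 (kernel certificate about OUR model; not a verdict)] -/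
theorem not_existsAdmissibleFiniteRay {ℓ : ℕ} (hℓ : 2 ≤ ℓ) :
    ¬ ∃ ε' : MvPowerSeries (Fin 3) 𝔽, MemBelow 2 1 (Finsupp.single 2 1) 0 (toFin 𝔽 2 εB - ε') ∧
      ∃ X : StandardExpression 2 MvPowerSeries.X 1 ℓ ε', AdmissibleTop ℓ X := by
  rintro ⟨ε', hB, X, -, -, -, htop⟩
  obtain ⟨t, ht, hdeg⟩ := exists_topBlock_degree_ge hB X hℓ
  exact absurd (htop t ht) (not_lt.2 hdeg)

/-- **`ℓ = 3` (box)**: NO — a top-block term with `(2c)_{ω₁} ≥ 8 = p^ℓ`. [cite: Hironaka2017, Lem. 9.5 p.50 l.11–14 (kernel certificate about OUR model)] -/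
theorem T1_box_depth_three :
    ¬ ∃ ε' : MvPowerSeries (Fin 3) 𝔽, MemBelow 2 1 (Finsupp.single 2 1) 0 (toFin 𝔽 2 εB - ε') ∧
      ∃ X : StandardExpression 2 MvPowerSeries.X 1 3 ε',
        ∀ t ∈ topBlock X.support X.u, ∀ i : Fin 3, (2 • t.2.2) i < 2 ^ 3 :=
  not_existsAdmissibleFiniteRay_box (by norm_num)

/-- **`ℓ = 4` (box)**: NO — a top-block term with `(2c)_{ω₁} ≥ 16 = p^ℓ`. [cite: Hironaka2017, Lem. 9.5 p.50 l.11–14 (kernel certificate about OUR model)] -/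
theorem T2_box_depth_four :
    ¬ ∃ ε' : MvPowerSeries (Fin 3) 𝔽, MemBelow 2 1 (Finsupp.single 2 1) 0 (toFin 𝔽 2 εB - ε') ∧
      ∃ X : StandardExpression 2 MvPowerSeries.X 1 4 ε',
        ∀ t ∈ topBlock X.support X.u, ∀ i : Fin 3, (2 • t.2.2) i < 2 ^ 4 :=
  not_existsAdmissibleFiniteRay_box (by norm_num)

/-- The numbers at `ℓ = 3` for one expression: `α = e₂`, `β = 0`, and a top-block term with `(2c)_{ω₁} ≥ 8`.
[cite: Hironaka2017, Lem. 9.5 p.50 l.11–14 (kernel certificate about OUR model)] -/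
theorem T1_box_numbers {ε' : MvPowerSeries (Fin 3) 𝔽}
    (hB : MemBelow 2 1 (Finsupp.single 2 1) 0 (toFin 𝔽 2 εB - ε'))
    (X : StandardExpression 2 MvPowerSeries.X 1 3 ε') :
    alpha X.support X.u = Finsupp.single 2 1 ∧ beta X.support X.u = 0 ∧
      ∃ t ∈ topBlock X.support X.u, 8 ≤ (2 • t.2.2) 1 :=
  ⟨(topPair_eq hB X (by norm_num)).1, (topPair_eq hB X (by norm_num)).2,
    by simpa using exists_topBlock_coord_ge hB X (show 2 ≤ 3 by norm_num)⟩

end Summit.ResolutionOfSingularities.ResolutionOfSingularities.Theorems.CampaignW25.SB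

end
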